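import Summits.ValiantsHypothesis.ValiantsHypothesis.Theorems.BarrierLeverPartitionMinorsHitByVPPrincipalLayouts

/-!
# Route BarrierLever — item `PartitionMinorsHitByVP` (stmt-ValiantsHypothesis-19717):
# layouts within POLYNOMIAL DISTANCE of a principal one are hit exactly, `b = c + 3`

Helper file (`--supports stmt-ValiantsHypothesis-19717`; cell valiant-natproofs, rung V4, 𝒟-side, prover seat
val-np-p3). Closes NO item. An UNCONDITIONAL structural class of item 19717 of every size `r ≤ 2^h`, by an EXACT witness;
it contains all principal-type layouts (`…partitionMinor_hit_of_principal`) and all CO-SMALL layouts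
(`r ≥ 2^h − (h+h)^c`: then at most `(h+h)^c` rows can fail to be columns).

**Theorem (`partitionMinor_hit_of_nearPrincipal`).** Let `u, w : Fin r → Finset (Fin h)` be injective (`h ≥ 2`) and
suppose a map `β : Fin r → Fin r` sends the set `A = {i : u_i is not a column}` injectively to UNMATCHED columns
(`w (β i)` is not a row) — such a `β` exists exactly because rows and columns are equinumerous. If `|A| ≤ (h+h)^c` then
some `f ∈ SmallCircuits ℂ (h+h) (c+3)` makes the layout matrix of item 19717 nonsingular. *Witness.*
`f = ∏_a (1 + x_a y_a) + Σ_{i ∈ A} x^{u_i} · ∏_{c ∈ w_{β i}} y_c · ∏_{c ∉ w_{β i}} (1 + y_c)`, with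
`coeff_{x^U y^W} f = [U = W] + Σ_{i∈A} [U = u_i] [w_{β i} ⊆ W]` (`coeff_corrTerm`). After permuting the columns
(the matched column under its row, `β i` under `i ∈ A`) the matrix is block triangular with an identity block and the
INCLUSION MATRIX `([w_{β i} ⊆ w_{β i'}])_{i,i' ∈ A}` of distinct sets, unitriangular in the order of cardinalities.

WHAT THIS IS NOT: nothing for layouts far from principal ones (the content of item 19717); nothing on crux 14610.
-/

-- layout Summits/ValiantsHypothesis/ValiantsHypothesis forces the duplicated namespace component
set_option linter.dupNamespace false

namespace Summit.ValiantsHypothesis.ValiantsHypothesis.Theorems.BarrierLever.ProductStateSums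

open Finset MvPolynomial Literature.Barriers.ValiantsHypothesis Literature.Computability.AlgebraicComplexity

noncomputable section

variable {h : ℕ}

/-! ## 1. The correction terms and their coefficients -/

/-- Two partition exponents agree iff both halves agree. -/
theorem partitionExpo_inj (S V U W : Finset (Fin h))
    (heq : (∑ a ∈ S, Finsupp.single (Fin.castAdd h a) 1 + ∑ c ∈ V, Finsupp.single (Fin.natAdd h c) 1 :
      Fin (h + h) →₀ ℕ) =
      ∑ a ∈ U, Finsupp.single (Fin.castAdd h a) 1 + ∑ c ∈ W, Finsupp.single (Fin.natAdd h c) 1) :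
    S = U ∧ V = W := by
  constructor
  · ext a
    have h1 := congrArg (fun v => v (Fin.castAdd h a)) heq
    simp only [partitionExpo_apply_castAdd] at h1
    by_cases ha : a ∈ S <;> by_cases hb : a ∈ U <;> simp_all
  · ext c
    have h1 := congrArg (fun v => v (Fin.natAdd h c)) heq
    simp only [partitionExpo_apply_natAdd] at h1
    by_cases ha : c ∈ V <;> by_cases hb : c ∈ W <;> simp_all

/-- The `y`-part of a correction term expanded: `∏_c (y_c if c ∈ T, else 1 + y_c) = Σ_{t ∩ T = ∅} y^{tᶜ}`. -/
theorem yPart_eq_sum (T : Finset (Fin h)) :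
    (∏ c : Fin h, (if c ∈ T then X (Fin.natAdd h c) else 1 + X (Fin.natAdd h c)) :
      MvPolynomial (Fin (h + h)) ℂ) =
      ∑ t : Finset (Fin h), (if Disjoint t T then (1 : MvPolynomial (Fin (h + h)) ℂ) else 0) *
        monomial (∑ c ∈ tᶜ, Finsupp.single (Fin.natAdd h c) 1) 1 := by
  have hfac : ∀ c : Fin h, (if c ∈ T then X (Fin.natAdd h c) else 1 + X (Fin.natAdd h c) :
      MvPolynomial (Fin (h + h)) ℂ) =
      (if c ∉ T then (1 : MvPolynomial (Fin (h + h)) ℂ) else 0) + X (Fin.natAdd h c) := by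
    intro c; by_cases hc : c ∈ T <;> simp [hc]
  simp_rw [hfac]
  rw [Fintype.prod_add]
  refine Finset.sum_congr rfl fun t _ => ?_
  congr 1
  · rw [Finset.prod_boole]
    by_cases hd : Disjoint t T
    · rw [if_pos hd, if_pos (fun c hc => Finset.disjoint_left.mp hd hc)]
    · rw [if_neg hd, if_neg (fun hall => hd (Finset.disjoint_left.mpr fun c hc => hall c hc))]
  · rw [monomial_sum_one]
    rfl

/-- The correction term `x^S · ∏_c (y_c if c ∈ T, else 1 + y_c)` as a sum of monomials. -/
theorem corrTerm_eq_sum (S T : Finset (Fin h)) :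
    ((∏ a ∈ S, X (Fin.castAdd h a)) *
      ∏ c : Fin h, (if c ∈ T then X (Fin.natAdd h c) else 1 + X (Fin.natAdd h c)) :
      MvPolynomial (Fin (h + h)) ℂ) =
      ∑ t : Finset (Fin h), (if Disjoint t T then (1 : MvPolynomial (Fin (h + h)) ℂ) else 0) *
        monomial (∑ a ∈ S, Finsupp.single (Fin.castAdd h a) 1 +
          ∑ c ∈ tᶜ, Finsupp.single (Fin.natAdd h c) 1) 1 := by
  have hx : (∏ a ∈ S, X (Fin.castAdd h a) : MvPolynomial (Fin (h + h)) ℂ) =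
      monomial (∑ a ∈ S, Finsupp.single (Fin.castAdd h a) 1) 1 := by
    rw [monomial_sum_one]; rfl
  rw [yPart_eq_sum, hx, Finset.mul_sum]
  refine Finset.sum_congr rfl fun t _ => ?_
  rw [mul_left_comm, monomial_mul, one_mul]

/-- **Coefficients of a correction term**: `coeff_{x^U y^W} (x^S ∏_c (…)) = [U = S] · [T ⊆ W]`. -/
theorem coeff_corrTerm (S T U W : Finset (Fin h)) :
    coeff (∑ a ∈ U, Finsupp.single (Fin.castAdd h a) 1 + ∑ c ∈ W, Finsupp.single (Fin.natAdd h c) 1)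
      ((∏ a ∈ S, X (Fin.castAdd h a)) *
        ∏ c : Fin h, (if c ∈ T then X (Fin.natAdd h c) else 1 + X (Fin.natAdd h c)) :
        MvPolynomial (Fin (h + h)) ℂ) = if U = S ∧ T ⊆ W then 1 else 0 := by
  rw [corrTerm_eq_sum, coeff_sum]
  have hterm : ∀ t : Finset (Fin h),
      coeff (∑ a ∈ U, Finsupp.single (Fin.castAdd h a) 1 + ∑ c ∈ W, Finsupp.single (Fin.natAdd h c) 1)
        ((if Disjoint t T then (1 : MvPolynomial (Fin (h + h)) ℂ) else 0) *
          monomial (∑ a ∈ S, Finsupp.single (Fin.castAdd h a) 1 +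
            ∑ c ∈ tᶜ, Finsupp.single (Fin.natAdd h c) 1) 1) =
      if t = Wᶜ ∧ (U = S ∧ T ⊆ W) then 1 else 0 := by
    intro t
    by_cases hd : Disjoint t T
    · rw [if_pos hd, one_mul, coeff_monomial]
      by_cases heq : (∑ a ∈ S, Finsupp.single (Fin.castAdd h a) 1 +
          ∑ c ∈ tᶜ, Finsupp.single (Fin.natAdd h c) 1 : Fin (h + h) →₀ ℕ) =
          ∑ a ∈ U, Finsupp.single (Fin.castAdd h a) 1 + ∑ c ∈ W, Finsupp.single (Fin.natAdd h c) 1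
      · obtain ⟨hSU, htW⟩ := partitionExpo_inj S tᶜ U W heq
        rw [if_pos heq, if_pos]
        refine ⟨by rw [← htW, compl_compl], hSU.symm, ?_⟩
        rw [← htW]
        exact fun c hc => Finset.mem_compl.mpr (fun hct => Finset.disjoint_left.mp hd hct hc)
      · rw [if_neg heq, if_neg]
        rintro ⟨rfl, rfl, -⟩
        exact heq (by rw [compl_compl])
    · rw [if_neg hd, zero_mul, coeff_zero, if_neg]
      rintro ⟨rfl, -, hTW⟩
      exact hd (Finset.disjoint_left.mpr fun c hc hcT => (Finset.mem_compl.mp hc) (hTW hcT))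
  simp_rw [hterm]
  by_cases hc : U = S ∧ T ⊆ W
  · rw [if_pos hc, Finset.sum_eq_single Wᶜ]
    · rw [if_pos ⟨rfl, hc⟩]
    · intro t _ ht; rw [if_neg (fun h' => ht h'.1)]
    · intro hn; exact absurd (mem_univ _) hn
  · rw [if_neg hc]
    exact Finset.sum_eq_zero fun t _ => by rw [if_neg (fun h' => hc h'.2)]

/-! ## 2. Degree and size of the witness -/

/-- A correction term has degree `≤ 2h`. -/
theorem totalDegree_corrTerm_le (S T : Finset (Fin h)) :
    ((∏ a ∈ S, X (Fin.castAdd h a)) *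
      ∏ c : Fin h, (if c ∈ T then X (Fin.natAdd h c) else 1 + X (Fin.natAdd h c)) :
      MvPolynomial (Fin (h + h)) ℂ).totalDegree ≤ h + h := by
  refine (totalDegree_mul _ _).trans ?_
  gcongr
  · refine (totalDegree_finsetProd _ _).trans ?_
    calc ∑ a ∈ S, (X (Fin.castAdd h a) : MvPolynomial (Fin (h + h)) ℂ).totalDegree
        = ∑ _a ∈ S, 1 := Finset.sum_congr rfl fun a _ => totalDegree_X _
      _ ≤ ∑ _a : Fin h, 1 := Finset.sum_le_sum_of_subset (Finset.subset_univ S)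
      _ = h := by simp
  · refine (totalDegree_finsetProd _ _).trans ?_
    calc ∑ c : Fin h, (if c ∈ T then X (Fin.natAdd h c) else 1 + X (Fin.natAdd h c) :
          MvPolynomial (Fin (h + h)) ℂ).totalDegree ≤ ∑ _c : Fin h, 1 :=
          Finset.sum_le_sum fun c _ => by
            split_ifs
            · exact (totalDegree_X _).le
            · exact (totalDegree_add _ _).trans (max_le (by simp) (totalDegree_X _).le)
      _ = h := by simp

/-- A correction term has size `≤ 3h + 1`. -/
theorem complexity_corrTerm_le (S T : Finset (Fin h)) :
    complexity ((∏ a ∈ S, X (Fin.castAdd h a)) *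
      ∏ c : Fin h, (if c ∈ T then X (Fin.natAdd h c) else 1 + X (Fin.natAdd h c)) :
      MvPolynomial (Fin (h + h)) ℂ) ≤ 3 * h + 1 := by
  have h1 : complexity (∏ a ∈ S, X (Fin.castAdd h a) : MvPolynomial (Fin (h + h)) ℂ) ≤ h := by
    refine (complexity_finset_prod_le _ _).trans ?_
    rw [Finset.sum_eq_zero (fun a _ => complexity_X_holds (Fin.castAdd h a)), zero_add]
    exact (Finset.card_le_univ S).trans (by simp)
  have h2 : complexity (∏ c : Fin h, (if c ∈ T then X (Fin.natAdd h c) else 1 + X (Fin.natAdd h c)) :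
      MvPolynomial (Fin (h + h)) ℂ) ≤ 2 * h := by
    refine (complexity_finset_prod_le _ _).trans ?_
    have hfac : ∀ c : Fin h, complexity ((if c ∈ T then X (Fin.natAdd h c) else 1 + X (Fin.natAdd h c)) :
        MvPolynomial (Fin (h + h)) ℂ) ≤ 1 := by
      intro c
      split_ifs
      · exact (complexity_X_holds _).le.trans (Nat.zero_le _)
      · calc complexity (1 + X (Fin.natAdd h c) : MvPolynomial (Fin (h + h)) ℂ)
            ≤ complexity (1 : MvPolynomial (Fin (h + h)) ℂ) +
                complexity (X (Fin.natAdd h c) : MvPolynomial (Fin (h + h)) ℂ) + 1 := complexity_add_le_holds _ _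
          _ = 1 := by rw [← C_1, complexity_C_holds, complexity_X_holds]
    calc ∑ c : Fin h, complexity ((if c ∈ T then X (Fin.natAdd h c) else 1 + X (Fin.natAdd h c)) :
          MvPolynomial (Fin (h + h)) ℂ) + (univ : Finset (Fin h)).card
        ≤ ∑ _c : Fin h, 1 + (univ : Finset (Fin h)).card := by gcongr with c _; exact hfac c
      _ = 2 * h := by simp; ring
  calc complexity ((∏ a ∈ S, X (Fin.castAdd h a)) *
        ∏ c : Fin h, (if c ∈ T then X (Fin.natAdd h c) else 1 + X (Fin.natAdd h c)) :
        MvPolynomial (Fin (h + h)) ℂ)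
      ≤ complexity (∏ a ∈ S, X (Fin.castAdd h a) : MvPolynomial (Fin (h + h)) ℂ) +
          complexity (∏ c : Fin h, (if c ∈ T then X (Fin.natAdd h c) else 1 + X (Fin.natAdd h c)) :
            MvPolynomial (Fin (h + h)) ℂ) + 1 := complexity_mul_le_holds _ _
    _ ≤ h + 2 * h + 1 := by gcongr
    _ = 3 * h + 1 := by ring

/-! ## 3. The inclusion matrix of distinct sets is unimodular -/

/-- The inclusion matrix `([S_i ⊆ S_j])` of an injective family of finite sets has determinant `1`
(block triangular for the cardinality grading, with identity diagonal blocks). -/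
theorem det_inclusionMatrix {ι : Type*} [Fintype ι] [DecidableEq ι] (S : ι → Finset (Fin h))
    (hS : Function.Injective S) :
    (Matrix.of fun i j : ι => if S i ⊆ S j then (1 : ℂ) else 0).det = 1 := by
  have hBT : (Matrix.of fun i j : ι => if S i ⊆ S j then (1 : ℂ) else 0).BlockTriangular
      (fun i => (S i).card) := by
    intro i j hij
    simp only [Matrix.of_apply]
    rw [if_neg]
    exact fun hsub => (Nat.lt_irrefl _) (lt_of_lt_of_le hij (Finset.card_le_card hsub))
  rw [Matrix.BlockTriangular.det hBT]
  refine Finset.prod_eq_one fun k _ => ?_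
  have hblock : (Matrix.of fun i j : ι => if S i ⊆ S j then (1 : ℂ) else 0).toSquareBlock
      (fun i => (S i).card) k = 1 := by
    ext ⟨i, hi⟩ ⟨j, hj⟩
    simp only [Matrix.toSquareBlock_def, Matrix.of_apply, Matrix.one_apply, Subtype.mk.injEq]
    by_cases hij : i = j
    · subst hij; simp
    · rw [if_neg, if_neg hij]
      intro hsub
      have hcard : (S j).card ≤ (S i).card := by
        have hi' : (S i).card = k := hi
        have hj' : (S j).card = k := hj
        omega
      exact hij (hS (Finset.eq_of_subset_of_card_le hsub hcard))
  rw [hblock, Matrix.det_one]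

/-! ## 4. The theorem -/

/-- **Near-principal layouts are hit** (`b = c + 3`, `h ≥ 2`). `A` is the set of rows that are not columns;
`β` sends `A` injectively to columns that are not rows; `|A| ≤ (h+h)^c`. -/
theorem partitionMinor_hit_of_nearPrincipal (c h : ℕ) (hh : 2 ≤ h) (r : ℕ)
    (u w : Fin r → Finset (Fin h)) (hu : Function.Injective u) (hw : Function.Injective w)
    (β : Fin r → Fin r)
    (hβ : ∀ i, (∀ j, w j ≠ u i) → ∀ i', u i' ≠ w (β i))
    (hβinj : ∀ i i', (∀ j, w j ≠ u i) → (∀ j, w j ≠ u i') → β i = β i' → i = i')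
    (hA : (univ.filter (fun i : Fin r => ∀ j, w j ≠ u i)).card ≤ (h + h) ^ c) :
    ∃ f ∈ SmallCircuits ℂ (h + h) (c + 3),
      (Matrix.of fun i j : Fin r => MvPolynomial.coeff
        (∑ a ∈ u i, Finsupp.single (Fin.castAdd h a) 1 +
          ∑ c ∈ w j, Finsupp.single (Fin.natAdd h c) 1) f).det ≠ 0 := by
  classical
  set A : Finset (Fin r) := univ.filter (fun i : Fin r => ∀ j, w j ≠ u i) with hAdef
  have hmemA : ∀ i, i ∈ A ↔ ∀ j, w j ≠ u i := fun i => by simp [hAdef]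
  -- the witness
  set f : MvPolynomial (Fin (h + h)) ℂ :=
    (∏ a : Fin h, (1 + X (Fin.castAdd h a) * X (Fin.natAdd h a))) +
      ∑ i ∈ A, ((∏ a ∈ u i, X (Fin.castAdd h a)) *
        ∏ c : Fin h, (if c ∈ w (β i) then X (Fin.natAdd h c) else 1 + X (Fin.natAdd h c))) with hf
  refine ⟨f, ⟨?_, ?_⟩, ?_⟩
  · -- degree
    refine (totalDegree_add _ _).trans (max_le (diagState_mem_smallCircuits (le_trans (by norm_num) hh)).1 ?_)
    exact (totalDegree_finsetSum _ _).trans (Finset.sup_le fun i _ => totalDegree_corrTerm_le _ _)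
  · -- size
    have hdiag := (diagState_mem_smallCircuits (h := h) (le_trans (by norm_num) hh)).2
    have hsum : complexity (∑ i ∈ A, ((∏ a ∈ u i, X (Fin.castAdd h a)) *
        ∏ c : Fin h, (if c ∈ w (β i) then X (Fin.natAdd h c) else 1 + X (Fin.natAdd h c))) :
        MvPolynomial (Fin (h + h)) ℂ) ≤ A.card * (3 * h + 1) + A.card := by
      refine (complexity_finset_sum_le _ _).trans ?_
      gcongr
      calc ∑ i ∈ A, complexity ((∏ a ∈ u i, X (Fin.castAdd h a)) *
            ∏ c : Fin h, (if c ∈ w (β i) then X (Fin.natAdd h c) else 1 + X (Fin.natAdd h c)) :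
            MvPolynomial (Fin (h + h)) ℂ) ≤ ∑ _i ∈ A, (3 * h + 1) :=
            Finset.sum_le_sum fun i _ => complexity_corrTerm_le _ _
        _ = A.card * (3 * h + 1) := by simp
    have hP : 1 ≤ (h + h) ^ c := Nat.one_le_pow _ _ (by omega)
    have hcube : (h + h) ^ 2 + 3 * h + 3 ≤ (h + h) ^ 3 := by nlinarith
    calc complexity f ≤ complexity (∏ a : Fin h, (1 + X (Fin.castAdd h a) * X (Fin.natAdd h a)) :
            MvPolynomial (Fin (h + h)) ℂ) +
          complexity (∑ i ∈ A, ((∏ a ∈ u i, X (Fin.castAdd h a)) *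
            ∏ c : Fin h, (if c ∈ w (β i) then X (Fin.natAdd h c) else 1 + X (Fin.natAdd h c))) :
            MvPolynomial (Fin (h + h)) ℂ) + 1 := complexity_add_le_holds _ _
      _ ≤ (h + h) ^ 2 + (A.card * (3 * h + 1) + A.card) + 1 := by gcongr
      _ = (h + h) ^ 2 + A.card * (3 * h + 2) + 1 := by ring
      _ ≤ (h + h) ^ 2 + (h + h) ^ c * (3 * h + 2) + 1 := by gcongr
      _ ≤ (h + h) ^ c * (h + h) ^ 2 + (h + h) ^ c * (3 * h + 2) + (h + h) ^ c * 1 := by nlinarith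
      _ = (h + h) ^ c * ((h + h) ^ 2 + 3 * h + 3) := by ring
      _ ≤ (h + h) ^ c * (h + h) ^ 3 := by gcongr
      _ = (h + h) ^ (c + 3) := by ring
  · -- the matrix entries
    have hentry : ∀ i j : Fin r, MvPolynomial.coeff
        (∑ a ∈ u i, Finsupp.single (Fin.castAdd h a) 1 + ∑ c ∈ w j, Finsupp.single (Fin.natAdd h c) 1) f =
        (if u i = w j then 1 else 0) + (if i ∈ A ∧ w (β i) ⊆ w j then 1 else 0) := by
      intro i j
      rw [hf, coeff_add, coeff_diagState, coeff_sum]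
      congr 1
      simp_rw [coeff_corrTerm]
      by_cases hiA : i ∈ A
      · rw [Finset.sum_eq_single i]
        · by_cases hsub : w (β i) ⊆ w j
          · rw [if_pos ⟨rfl, hsub⟩, if_pos ⟨hiA, hsub⟩]
          · rw [if_neg (fun h' => hsub h'.2), if_neg (fun h' => hsub h'.2)]
        · intro k _ hk; rw [if_neg]; exact fun h' => hk (hu h'.1.symm)
        · intro hn; exact absurd hiA hn
      · rw [if_neg (fun h' => hiA h'.1)]
        exact Finset.sum_eq_zero fun k hk => by
          rw [if_neg]; rintro ⟨huk, -⟩; exact hiA (hu huk ▸ hk)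
    -- the column permutation: matched column under its row, `β i` under `i ∈ A`
    have hmatch : ∀ i, i ∉ A → ∃ j, w j = u i := fun i hi => by
      by_contra hcon; push Not at hcon; exact hi ((hmemA i).mpr hcon)
    let κf : Fin r → Fin r := fun i => if hi : i ∈ A then β i else (hmatch i hi).choose
    have hκ_notA : ∀ i (hi : i ∉ A), w (κf i) = u i := fun i hi => by
      simp only [κf, dif_neg hi]; exact (hmatch i hi).choose_spec
    have hκ_A : ∀ i, i ∈ A → κf i = β i := fun i hi => by simp only [κf, dif_pos hi]
    have hκinj : Function.Injective κf := by
      intro i i' hii'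
      by_cases hi : i ∈ A <;> by_cases hi' : i' ∈ A
      · rw [hκ_A i hi, hκ_A i' hi'] at hii'
        exact hβinj i i' ((hmemA i).mp hi) ((hmemA i').mp hi') hii'
      · exfalso
        have h1 := hκ_notA i' hi'
        rw [← hii', hκ_A i hi] at h1
        exact hβ i ((hmemA i).mp hi) i' h1.symm
      · exfalso
        have h1 := hκ_notA i hi
        rw [hii', hκ_A i' hi'] at h1
        exact hβ i' ((hmemA i').mp hi') i h1.symm
      · apply hu
        rw [← hκ_notA i hi, ← hκ_notA i' hi', hii']
    let κ : Equiv.Perm (Fin r) := Equiv.ofBijective κf (Finite.injective_iff_bijective.mp hκinj)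
    have hκ : ∀ i, κ i = κf i := fun i => rfl
    -- the permuted matrix
    set M : Matrix (Fin r) (Fin r) ℂ := Matrix.of fun i j : Fin r => MvPolynomial.coeff
        (∑ a ∈ u i, Finsupp.single (Fin.castAdd h a) 1 + ∑ c ∈ w j, Finsupp.single (Fin.natAdd h c) 1) f
      with hM
    have hM' : M.submatrix id κ = Matrix.of fun i i' : Fin r =>
        if i ∈ A then (if w (β i) ⊆ w (κf i') then (1 : ℂ) else 0) else (if i = i' then 1 else 0) := by
      ext i i'
      rw [Matrix.submatrix_apply, hM, Matrix.of_apply, Matrix.of_apply, hentry, id, hκ]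
      by_cases hi : i ∈ A
      · rw [if_pos hi]
        have h1 : u i ≠ w (κf i') := by
          by_cases hi' : i' ∈ A
          · rw [hκ_A i' hi']; exact fun e => hβ i' ((hmemA i').mp hi') i e
          · rw [hκ_notA i' hi']; exact fun e => hi' (by rw [← hu e]; exact hi)
        rw [if_neg h1, zero_add]
        by_cases hs : w (β i) ⊆ w (κf i') <;> simp [hi, hs]
      · rw [if_neg hi]
        rw [show (if i ∈ A ∧ w (β i) ⊆ w (κf i') then (1 : ℂ) else 0) = 0 from
          if_neg (fun h' => hi h'.1), add_zero]
        by_cases hi' : i' ∈ A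
        · rw [hκ_A i' hi', if_neg, if_neg]
          · rintro rfl; exact hi hi'
          · exact fun e => hβ i' ((hmemA i').mp hi') i e
        · rw [hκ_notA i' hi']
          simp only [hu.eq_iff]
    -- determinant
    have htri : ∀ i, ¬ (i ∈ A) → ∀ j, j ∈ A →
        (Matrix.of fun i i' : Fin r => if i ∈ A then (if w (β i) ⊆ w (κf i') then (1 : ℂ) else 0)
          else (if i = i' then 1 else 0)) i j = 0 := by
      intro i hi j hj
      simp only [Matrix.of_apply]
      rw [if_neg hi, if_neg]
      rintro rfl; exact hi hj
    have step := Matrix.twoBlockTriangular_det (Matrix.of fun i i' : Fin r =>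
        if i ∈ A then (if w (β i) ⊆ w (κf i') then (1 : ℂ) else 0) else (if i = i' then 1 else 0))
      (fun i => i ∈ A) htri
    have hb1 : ((Matrix.of fun i i' : Fin r => if i ∈ A then (if w (β i) ⊆ w (κf i') then (1 : ℂ) else 0)
        else (if i = i' then 1 else 0)).toSquareBlockProp (fun i => i ∈ A)) =
        Matrix.of fun i i' : {i // i ∈ A} => if w (β i.1) ⊆ w (β i'.1) then (1 : ℂ) else 0 := by
      ext ⟨i, hi⟩ ⟨i', hi'⟩
      simp [Matrix.toSquareBlockProp_def, hκ_A i' hi']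
    have hb2 : ((Matrix.of fun i i' : Fin r => if i ∈ A then (if w (β i) ⊆ w (κf i') then (1 : ℂ) else 0)
        else (if i = i' then 1 else 0)).toSquareBlockProp (fun i => ¬ i ∈ A)) = 1 := by
      ext ⟨i, hi⟩ ⟨i', hi'⟩
      simp [Matrix.toSquareBlockProp_def, hi, Matrix.one_apply]
    have hincl : (Matrix.of fun i i' : {i // i ∈ A} =>
        if w (β i.1) ⊆ w (β i'.1) then (1 : ℂ) else 0).det = 1 := by
      refine det_inclusionMatrix (fun i : {i // i ∈ A} => w (β i.1)) ?_
      intro i i' hii'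
      exact Subtype.ext (hβinj _ _ ((hmemA _).mp i.2) ((hmemA _).mp i'.2) (hw hii'))
    intro hdet0
    have hperm := Matrix.det_permute' κ M
    rw [hdet0, mul_zero, hM', step, hb1, hb2, Matrix.det_one, mul_one] at hperm
    have key : (1 : ℂ) = 0 := by
      rw [← hincl]
      convert hperm using 2
    exact one_ne_zero key

end

end Summit.ValiantsHypothesis.ValiantsHypothesis.Theorems.BarrierLever.ProductStateSums
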